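import Summits.KontsevichZagierPeriods.KontsevichZagierPeriods.Theorems.OctahedralSymmetryOctahedralSpanAllWeightsStubWeightFiveRowCert

/-!
# Crux `OctahedralSpanAllWeights` (stmt-KontsevichZagierPeriods-9659), line `Sketch`:
# row tables with explicit boundary values (helper for stub `stub_weight_five`)

`…StubWeightFiveRowCert` feeds a fat certificate to the kernel in slices, the checker computing the
partial sums (`FVec5.collect`) and keeping them for citation. One kernel decision replays about
`1.5·10⁴` expansion terms, so the slices of one fat certificate may have to be spread over SEVERAL
decisions (chunks) — and a computed partial sum cannot be carried from one decision to the next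
without recomputing it. This file adds rows with an EXPLICIT value: an auxiliary row may state its
partial sum `v` as data; the checker verifies `v − rhs = 0` by the radix test and keeps `v` itself.
A chunk can then end with an explicit row and the next chunk start from the literal `[v]`, whose
membership in `rel ⊔ twoSpan w` is the previous chunk's conclusion.
* `YCert` (optional word, optional explicit value, `nf`, `refs`, cited `rows`, `gens`), `YCert.toX`
  (the underlying `XCert`: same `rhs`, same data checks), checker `YCert.ok`, steps
  `YCert.wordsStep` / `YCert.rowsStep`, `YCert.wordsAfter` / `YCert.rowsAfter`;
* `ytableOk w earlier erows T` and the registered helper stub `ytable_sound`;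
* the `ℤ`-scaled format `ZYCert` / `ZYCert.toYCert` of the weight-5 tables.

Sources: J. Zhao, Doc. Math. 15 (2010), §2, §5; J. Zhao, C. R. Acad. Sci. Paris 346 (2008), §4
(the relation families); reflection set-up of `…StubWeightTwo` / `…RefCert` / `…RowCert`.
-/

namespace Summit.KontsevichZagierPeriods.OctahedralSymmetry.OctaSpan

open Literature.NumberTheory.Transcendental Literature.NumberTheory.Transcendental.LevelFour
open FVec5

/-- A row with an optional EXPLICIT value: `word = some W` a word row; `word = none, val = none`
an auxiliary row whose value is computed (`collect` of its right-hand side); `word = none,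
val = some v` an auxiliary row stating its value `v` (checked: `v − rhs = 0`). [folklore] -/
structure YCert where
  /-- `some W`: a word row certifying `W`; `none`: an auxiliary row -/
  word : Option (List (Fin 5))
  /-- `some v`: the explicit value of an auxiliary row -/
  val : Option FVec5
  /-- two-letter words with coefficients -/
  nf : FVec5
  /-- earlier-certified words with coefficients -/
  refs : FVec5
  /-- cited earlier auxiliary rows: (index, coefficient), index `0` = the most recent -/
  rows : List (ℕ × ℚ)
  /-- generator terms with coefficients -/
  gens : List (GenTerm × ℚ)

namespace YCert

/-- The underlying row of `…RowCert` (same right-hand side, same data checks). [folklore] -/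
def toX (c : YCert) : XCert := ⟨c.word, c.nf, c.refs, c.rows, c.gens⟩

/-- **The checker**: a word row is checked as in `…RowCert`; a computed auxiliary row needs only
the data checks; an explicit auxiliary row also passes the radix test of `v − rhs`. [folklore] -/
def ok (w : ℕ) (earlier : List (List (Fin 5))) (erows : List FVec5) (c : YCert) : Bool :=
  match c.word, c.val with
  | some _, _ => c.toX.ok w earlier erows
  | none, none => c.toX.dataOk w earlier
  | none, some v => c.toX.dataOk w earlier && zeroTest (w + 1) (v ++ smul (-1) (c.toX.rhs erows))

/-- The certified words after one row. [folklore] -/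
def wordsStep (c : YCert) (earlier : List (List (Fin 5))) : List (List (Fin 5)) :=
  match c.word with
  | some W => W :: earlier
  | none => earlier

/-- The auxiliary values after one row: computed rows push the collected right-hand side,
explicit rows push their stated value. [folklore] -/
def rowsStep (w : ℕ) (c : YCert) (erows : List FVec5) : List FVec5 :=
  match c.word, c.val with
  | some _, _ => erows
  | none, none => collect (w + 1) (c.toX.rhs erows) :: erows
  | none, some v => v :: erows

/-- The certified words after the table `T` (most recent first). [folklore] -/
def wordsAfter : List YCert → List (List (Fin 5)) → List (List (Fin 5))
  | [], earlier => earlier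
  | c :: T, earlier => wordsAfter T (c.wordsStep earlier)

/-- The auxiliary values after the table `T`. [folklore] -/
def rowsAfter (w : ℕ) : List YCert → List FVec5 → List FVec5
  | [], erows => erows
  | c :: T, erows => rowsAfter w T (c.rowsStep w erows)

/-- **Soundness of one row**: the words and values after an accepted row realise into
`rel ⊔ twoSpan w` if those before it do. [folklore] -/
theorem sound (w : ℕ) (earlier : List (List (Fin 5))) (erows : List FVec5) (c : YCert)
    (h : c.ok w earlier erows = true) (hE : ∀ U ∈ earlier, sym U ∈ rel ⊔ twoSpan w)
    (hR : ∀ v ∈ erows, eval v ∈ rel ⊔ twoSpan w) :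
    (∀ U ∈ c.wordsStep earlier, sym U ∈ rel ⊔ twoSpan w) ∧
      ∀ v ∈ c.rowsStep w erows, eval v ∈ rel ⊔ twoSpan w := by
  unfold ok at h
  unfold wordsStep rowsStep
  cases hcw : c.word with
  | some W =>
    rw [hcw] at h
    refine ⟨fun U hU => ?_, hR⟩
    rcases List.mem_cons.1 hU with rfl | hU
    · exact XCert.sound_word w earlier erows c.toX U (by simp [toX, hcw]) h hE hR
    · exact hE U hU
  | none =>
    rw [hcw] at h
    cases hcv : c.val with
    | none =>
      rw [hcv] at h
      refine ⟨hE, fun v hv => ?_⟩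
      rcases List.mem_cons.1 hv with rfl | hv
      · rw [eval_collect]
        exact XCert.rhs_mem w earlier erows c.toX h hE hR
      · exact hR v hv
    | some u =>
      rw [hcv] at h
      simp only [Bool.and_eq_true] at h
      refine ⟨hE, fun v hv => ?_⟩
      rcases List.mem_cons.1 hv with rfl | hv
      · have h0 := eval_eq_zero_of_zeroTest h.2
        rw [eval_append, eval_smul, neg_one_smul, ← sub_eq_add_neg, sub_eq_zero] at h0
        rw [h0]
        exact XCert.rhs_mem w earlier erows c.toX h.1 hE hR
      · exact hR v hv

end YCert

/-- **The table checker** for rows with explicit values. [folklore] -/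
def ytableOk (w : ℕ) : List (List (Fin 5)) → List FVec5 → List YCert → Bool
  | _, _, [] => true
  | earlier, erows, c :: T =>
      c.ok w earlier erows && ytableOk w (c.wordsStep earlier) (c.rowsStep w erows) T

/-- **Soundness of a checked table** (registered helper stub `ytable_sound`): if `ytableOk` accepts
`T` on top of words and values realising into `rel ⊔ twoSpan w`, so do all words and values after
`T`. [folklore] -/
theorem ytable_sound (w : ℕ) (earlier : List (List (Fin 5))) (erows : List FVec5) (T : List YCert)
    (hT : ytableOk w earlier erows T = true) (hE : ∀ U ∈ earlier, sym U ∈ rel ⊔ twoSpan w)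
    (hR : ∀ v ∈ erows, eval v ∈ rel ⊔ twoSpan w) :
    (∀ U ∈ YCert.wordsAfter T earlier, sym U ∈ rel ⊔ twoSpan w) ∧
      ∀ v ∈ YCert.rowsAfter w T erows, eval v ∈ rel ⊔ twoSpan w := by
  induction T generalizing earlier erows with
  | nil => simpa [YCert.wordsAfter, YCert.rowsAfter] using ⟨hE, hR⟩
  | cons c T ih =>
    simp only [ytableOk, Bool.and_eq_true] at hT
    have hc := YCert.sound w earlier erows c hT.1 hE hR
    exact ih (c.wordsStep earlier) (c.rowsStep w erows) hT.2 hc.1 hc.2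

/-- A `ℤ`-scaled row `⟨word?, val?, den, nf, refs, rows, gens⟩` (the explicit value, if any, is kept
exact). [folklore] -/
structure ZYCert where
  /-- `some W` for a word row, `none` for an auxiliary row -/
  word : Option (List (Fin 5))
  /-- `some v`: the explicit value of an auxiliary row -/
  val : Option FVec5
  /-- the common denominator -/
  den : ℕ
  /-- two-letter part, scaled by `den` -/
  nf : List (List (Fin 5) × ℤ)
  /-- references, scaled by `den` -/
  refs : List (List (Fin 5) × ℤ)
  /-- cited auxiliary rows, scaled by `den` -/
  rows : List (ℕ × ℤ)
  /-- generator terms, scaled by `den` -/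
  gens : List (GenTerm × ℤ)

/-- The row of a `ℤ`-scaled row (divide every coefficient by `den`). [folklore] -/
def ZYCert.toYCert (z : ZYCert) : YCert :=
  ⟨z.word, z.val, z.nf.map fun p => (p.1, (p.2 : ℚ) / z.den), z.refs.map fun p => (p.1, (p.2 : ℚ) / z.den),
    z.rows.map fun p => (p.1, (p.2 : ℚ) / z.den), z.gens.map fun p => (p.1, (p.2 : ℚ) / z.den)⟩

/-- Smoke test (kernel): `[2,2,2,2]` in three rows — a computed auxiliary row (`2 · dilGen`), an
EXPLICIT auxiliary row restating half of it as data (as a chunk boundary would), and the word row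
citing the explicit value. [folklore] -/
example : ytableOk 4 [] []
    [ZYCert.toYCert ⟨none, none, 1, [], [], [], [(.dil [2, 2, 2, 2], 2)]⟩,
     ZYCert.toYCert ⟨none, some [([2, 2, 2, 2], 1), ([1, 1, 1, 1], -1), ([1, 1, 1, 3], -1),
        ([1, 1, 3, 1], -1), ([1, 1, 3, 3], -1), ([1, 3, 1, 1], -1), ([1, 3, 1, 3], -1), ([1, 3, 3, 1], -1),
        ([1, 3, 3, 3], -1), ([3, 1, 1, 1], -1), ([3, 1, 1, 3], -1), ([3, 1, 3, 1], -1), ([3, 1, 3, 3], -1),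
        ([3, 3, 1, 1], -1), ([3, 3, 1, 3], -1), ([3, 3, 3, 1], -1), ([3, 3, 3, 3], -1)], 2, [], [], [(0, 1)],
        []⟩,
     ZYCert.toYCert ⟨some [2, 2, 2, 2], none, 1,
        [([1, 1, 1, 1], 1), ([1, 1, 1, 3], 1), ([1, 1, 3, 1], 1), ([1, 1, 3, 3], 1), ([1, 3, 1, 1], 1),
         ([1, 3, 1, 3], 1), ([1, 3, 3, 1], 1), ([1, 3, 3, 3], 1), ([3, 1, 1, 1], 1), ([3, 1, 1, 3], 1),
         ([3, 1, 3, 1], 1), ([3, 1, 3, 3], 1), ([3, 3, 1, 1], 1), ([3, 3, 1, 3], 1), ([3, 3, 3, 1], 1),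
         ([3, 3, 3, 3], 1)], [], [(0, 1)], []⟩] = true := by
  decide +kernel

end Summit.KontsevichZagierPeriods.OctahedralSymmetry.OctaSpan
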